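import Mathlib
import HarnessLib
import Summits.NavierStokesRegularity.NavierStokesRegularity.Theorems.PoloidalWindowDoorLrcModEntireJetCertPsatzElimIStage

/-!
# Jet-certificate checker — STAGED replay with LAZY MATERIALISATION of the laws (`…JetCertPsatzElimI` semantics)

Experiment cell `ns-wall-extremal`, arm C (PREREG-WALL-1 §C; C1b all-tilt cell T1′(5,3), ns-wall-eng-2's kill export j323178 of 209 laws / 643 050 terms),
seat ns-wall-eng-6 g3 (Lean hand; checker family and staging design of ns-crc-p1 g5/g6 and ns-wall-eng-6 g2), 2026-08-29.
`--supports stmt-NavierStokesRegularity-19708` (instrument).  Generic; no Navier–Stokes content.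

WHY: the staged replay of record (`…JetCertPsatzElimIStage`) carries the WHOLE law list in every explicit intermediate state, so every stage decodes
(and compares) the full in- and out-states; on a cell whose laws of ≥ 10⁴ terms are first CITED late in the transcript this alone exceeds the gate's
per-file budget (T1′(5,3) ∀γ: 86 % of the 643 k terms sit in laws first cited after step 160 of 317).  Here the replay state is instead
`(log of substitutions performed, adjoined laws, pins)`: an ORIGINAL law is MATERIALISED — the logged substitute-and-strip operations `substStripI`
applied to it in order, i.e. exactly what the eager replay did to that law — only at the step that cites it, and each original law is decoded once
in the whole chain (the laws are supplied as an index function `hyp : ℕ → QMvPoly`, so a stage evaluates only the laws it cites).  The transcript,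
its side conditions (`κ · pins^pe` coefficients, degrees, `hasVarPin`) and the conclusion `Kills` are those of `…ElimI` / `…ElimIStage`, word for word.

SOUNDNESS is the `…ElimI` argument with the invariant `LazyDatum`: «∃ z : every ORIGINAL law vanishes at z, every logged substitution `(i, num, c)`
satisfies `c(z)·z_i = num(z)`, every adjoined law vanishes at z, every pin is non-zero at z».  Materialisation preserves vanishing
(`ev_materialize_eq_zero`, by `ev_substStripI_eq_zero` along the log) — whatever sub-list of the performed substitutions the log keeps (the `keep`
flag of an `elim` step only decides whether later materialisations see it; dropping entries is sound, it can at most make a later check fail).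

* `LSub`, `LState`, `LStep`; `presentArr`, `materialize` (+ `ev_materialize_eq_zero`), `lawAt` (+ `ev_lawAt_eq_zero`); `runL` (+ `lazyDatum_runL`);
* `lazyStageCheck` (+ **`lazyDatum_of_stageCheck`**), `lazyFinalCheck` (+ **`not_lazyDatum_of_finalCheck`**), **`kills_of_lazyStages`**
  (`Kills n ((List.range N).map hyp) pins [] [] J` — the statement of `kills_of_killCheckI` for the listed laws);
* self-test (`decide +kernel`): the toy transcript of `…JetCertPsatzElimH`, two lazy stages + final slice.

WHAT THIS IS NOT: not a claim about Navier–Stokes, not a certificate; plumbing for exact census rows of an ansatz class. [folklore]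
-/

noncomputable section

-- the summit and its single sub-problem share the name (CONVENTIONS §1), as in every Theorems file
set_option linter.dupNamespace false

namespace Summit.NavierStokesRegularity.NavierStokesRegularity.Theorems.PoloidalWindowDoorLrcModEntireJetCertPsatzElimLazy

open _root_.Topology _root_.Filter Set
open Literature.Analysis.ValidatedNumerics Literature.Analysis.ValidatedNumerics.QMvPoly
open Literature.Analysis.Calculus.MvPoly
open Summit.NavierStokesRegularity.NavierStokesRegularity.Theorems.PoloidalWindowDoorLrcModEntireJetCertDefs
open Summit.NavierStokesRegularity.NavierStokesRegularity.Theorems.PoloidalWindowDoorLrcModEntireJetCertTree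
open Summit.NavierStokesRegularity.NavierStokesRegularity.Theorems.PoloidalWindowDoorLrcModEntireJetCertFast2
open Summit.NavierStokesRegularity.NavierStokesRegularity.Theorems.PoloidalWindowDoorLrcModEntireJetCertGauge
open Summit.NavierStokesRegularity.NavierStokesRegularity.Theorems.PoloidalWindowDoorLrcModEntireJetCertPsatz
open Summit.NavierStokesRegularity.NavierStokesRegularity.Theorems.PoloidalWindowDoorLrcModEntireJetCertPsatzSubst
open Summit.NavierStokesRegularity.NavierStokesRegularity.Theorems.PoloidalWindowDoorLrcModEntireJetCertPsatzElim
open Summit.NavierStokesRegularity.NavierStokesRegularity.Theorems.PoloidalWindowDoorLrcModEntireJetCertPsatzElimN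
open Summit.NavierStokesRegularity.NavierStokesRegularity.Theorems.PoloidalWindowDoorLrcModEntireJetCertPsatzElimG
open Summit.NavierStokesRegularity.NavierStokesRegularity.Theorems.PoloidalWindowDoorLrcModEntireJetCertPsatzElimH
open Summit.NavierStokesRegularity.NavierStokesRegularity.Theorems.PoloidalWindowDoorLrcModEntireJetCertPsatzElimI
open Summit.NavierStokesRegularity.NavierStokesRegularity.Theorems.PoloidalWindowDoorLrcModEntireJetCertPsatzElimHStage
open Summit.NavierStokesRegularity.NavierStokesRegularity.Theorems.PoloidalWindowDoorLrcModEntireJetCertPsatzElimIStage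

variable {n : ℕ}

/-! ### States and steps -/

/-- One LOGGED substitution `c · X_i = num` (the pivot relation of an `elim` step, read at the real point: `c(z)·z_i = num(z)`). [folklore] -/
structure LSub where
  /-- the eliminated letter -/
  i : ℕ
  /-- numerator: `X_i = num / c` -/
  num : QMvPoly
  /-- the pivot coefficient -/
  c : QMvPoly

/-- The LAZY replay state: the substitution log, the adjoined laws `X_j` (kept substituted, as in the eager replay), the pins (substituted). [folklore] -/
structure LState where
  /-- substitutions performed so far that later materialisations must see -/
  log : List LSub
  /-- adjoined laws (from `force` steps), eagerly substituted and stripped -/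
  adj : List QMvPoly
  /-- the pins (cell pins, then the twist pin), eagerly substituted -/
  pins : List QMvPoly

/-- One transcript step: `elim k i κ pe keep` (pivot law `k`, letter `i`, coefficient `κ · pins^pe`; `keep` = log the substitution for later
materialisations) or `force k j κ pe e` (law `k` reads `κ · pins^pe · X_j^e`, so `X_j = 0` is adjoined).  Law index `k < N` = original law `hyp k`
(materialised), `k ≥ N` = adjoined law `k − N`. [folklore] -/
inductive LStep : Type
  | elim (k i : ℕ) (κ : ℚ) (pe : List ℕ) (keep : Bool)
  | force (k j : ℕ) (κ : ℚ) (pe : List ℕ) (e : ℕ)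

/-! ### Materialisation -/

/-- Mark the letters of one exponent vector in a Boolean array. [folklore] -/
def markMono (a : Array Bool) (m : List ℕ) : Array Bool :=
  (m.zipIdx).foldl (fun a p => if p.1 ≠ 0 then a.setIfInBounds p.2 true else a) a

/-- The letters occurring in `P` (Boolean array of length `n`; a cache only — soundness does not depend on it). [folklore] -/
def presentArr (n : ℕ) (P : QMvPoly) : Array Bool := P.foldl (fun a t => markMono a t.1) (Array.replicate n false)

/-- MATERIALISE a law under a substitution log: apply `substStripI` for every logged substitution whose letter (by the cache) occurs, in order.
Skipping an entry whose letter does not occur is what `substStripI` itself would do; skipping for any other reason is still sound. [folklore] -/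
def materialize (n g : ℕ) : List LSub → QMvPoly → Array Bool → QMvPoly
  | [], P, _ => P
  | s :: σ, P, pr =>
      if pr.getD s.i false then
        (let P' := substStripI n g s.i s.num s.c P
         materialize n g σ P' (presentArr n P'))
      else materialize n g σ P pr

/-- Materialisation preserves vanishing at a point where every logged relation holds (and `z_g ≠ 0`). [folklore] -/
theorem ev_materialize_eq_zero (z : EuclideanSpace ℝ (Fin n)) (g : Fin n) (hg : z g ≠ 0) :
    ∀ (σ : List LSub) (P : QMvPoly) (pr : Array Bool),
      (∀ s ∈ σ, ∃ hi : s.i < n, ev n s.c z * z ⟨s.i, hi⟩ = ev n s.num z) → ev n P z = 0 → ev n (materialize n g σ P pr) z = 0 := by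
  intro σ
  induction σ with
  | nil => intro P pr _ hP; simpa [materialize] using hP
  | cons s σ ih =>
    intro P pr hσ hP
    have hs := hσ s (List.mem_cons_self ..)
    have hσ' : ∀ s' ∈ σ, ∃ hi : s'.i < n, ev n s'.c z * z ⟨s'.i, hi⟩ = ev n s'.num z := fun s' hs' => hσ s' (List.mem_cons_of_mem _ hs')
    simp only [materialize]
    split_ifs with hpr
    · obtain ⟨hi, hrel⟩ := hs
      exact ih _ _ hσ' (ev_substStripI_eq_zero z g ⟨s.i, hi⟩ s.num s.c hg hrel hP)
    · exact ih _ _ hσ' hP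

/-- The law a step cites: an original law, materialised under the current log, or an adjoined law. [folklore] -/
def lawAt (n g N : ℕ) (hyp : ℕ → QMvPoly) (s : LState) (k : ℕ) : QMvPoly :=
  if k < N then materialize n g s.log (hyp k) (presentArr n (hyp k)) else s.adj.getD (k - N) []

/-! ### The invariant -/

/-- **A LAZY DATUM**: a real point at which every original law `hyp k` (`k < N`) vanishes, every logged substitution holds as `c(z)·z_i = num(z)`,
every adjoined law vanishes and every pin is non-zero. [folklore] -/
def LazyDatum (n N : ℕ) (hyp : ℕ → QMvPoly) (s : LState) : Prop :=
  ∃ z : EuclideanSpace ℝ (Fin n), (∀ k, k < N → ev n (hyp k) z = 0) ∧ (∀ t ∈ s.log, ∃ hi : t.i < n, ev n t.c z * z ⟨t.i, hi⟩ = ev n t.num z) ∧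
    (∀ a ∈ s.adj, ev n a z = 0) ∧ (∀ π ∈ s.pins, ev n π z ≠ 0)

/-- A cited law vanishes at the point of a lazy datum (given `z_g ≠ 0`). [folklore] -/
theorem ev_lawAt_eq_zero {N : ℕ} {hyp : ℕ → QMvPoly} {s : LState} {z : EuclideanSpace ℝ (Fin n)} (g : Fin n) (hg : z g ≠ 0)
    (hh : ∀ k, k < N → ev n (hyp k) z = 0) (hσ : ∀ t ∈ s.log, ∃ hi : t.i < n, ev n t.c z * z ⟨t.i, hi⟩ = ev n t.num z)
    (ha : ∀ a ∈ s.adj, ev n a z = 0) (k : ℕ) : ev n (lawAt n g N hyp s k) z = 0 := by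
  unfold lawAt
  split_ifs with hk
  · exact ev_materialize_eq_zero z g hg s.log (hyp k) _ hσ (hh k hk)
  · exact ev_getD_eq_zero ha (k - N)

/-! ### The lazy replay and its soundness -/

/-- The log after an `elim` step: extended by the new substitution iff `keep`. [folklore] -/
def logStep (keep : Bool) (log : List LSub) (e : LSub) : List LSub := bif keep then log ++ [e] else log

/-- Membership in `logStep`: an old entry or the new one. [folklore] -/
theorem mem_logStep {keep : Bool} {log : List LSub} {e t : LSub} (h : t ∈ logStep keep log e) : t ∈ log ∨ t = e := by
  cases keep
  · exact Or.inl (by simpa [logStep] using h)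
  · simpa [logStep, List.mem_append, List.mem_singleton] using h


/-- **LAZY REPLAY**: run steps from a lazy state with exactly the side conditions of `runI` / `etreeCheckI` (plus `hasVarPin` on `force`, since the
cited law is materialised there too); `none` as soon as a side condition fails. [folklore] -/
def runL (n g N : ℕ) (hyp : ℕ → QMvPoly) : List LStep → LState → Option LState
  | [], s => some s
  | (.elim k i κ pe keep) :: rest, s =>
      let L := lawAt n g N hyp s k
      let c := coeffIn i L
      let num := QMvPoly.smul (-1) (restIn i L)
      if decide (i < n) && decide (g < n) && hasVarPin n g s.pins && decide (κ ≠ 0) && decide (degIn i L ≤ 1) &&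
          polyEq c (QMvPoly.smul κ (pinProductN s.pins pe)) then
        runL n g N hyp rest
          { log := logStep keep s.log ⟨i, num, c⟩,
            adj := s.adj.map (substStripI n g i num c),
            pins := s.pins.map (substLawN i num c) }
      else none
  | (.force k j κ pe e) :: rest, s =>
      let L := lawAt n g N hyp s k
      if decide (j < n) && decide (g < n) && hasVarPin n g s.pins && decide (κ ≠ 0) && decide (1 ≤ e) &&
          polyEq L (QMvPoly.smul κ (mulN (pinProductN s.pins pe) (powQN (QMvPoly.var n j) e))) then
        runL n g N hyp rest { log := s.log, adj := s.adj ++ [QMvPoly.var n j], pins := s.pins }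
      else none

/-- **SOUNDNESS OF THE LAZY REPLAY**: a lazy datum of the input state is a lazy datum of the output state (the SAME point). [folklore] -/
theorem lazyDatum_runL (g N : ℕ) (hyp : ℕ → QMvPoly) : ∀ (steps : List LStep) {s s' : LState},
    runL n g N hyp steps s = some s' → LazyDatum n N hyp s → LazyDatum n N hyp s' := by
  intro steps
  induction steps with
  | nil =>
    intro s s' h hd
    simp only [runL, Option.some.injEq] at h
    subst h
    exact hd
  | cons st rest ih =>
    intro s s' h hd
    cases st with
    | elim k i κ pe keep =>
      simp only [runL] at h
      split_ifs at h with hc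
      simp only [Bool.and_eq_true, decide_eq_true_eq] at hc
      obtain ⟨⟨⟨⟨⟨hi, hgn⟩, hvp⟩, hκ⟩, hdeg⟩, hcf⟩ := hc
      obtain ⟨z, hh, hσ, ha, hp⟩ := hd
      set L := lawAt n g N hyp s k with hL
      set c := coeffIn i L with hc_def
      set num := QMvPoly.smul (-1) (restIn i L) with hnum
      have hzg : z ⟨g, hgn⟩ ≠ 0 := zg_ne_zero_of_hasVarPin (g := ⟨g, hgn⟩) hvp hp
      have hcz : ev n c z ≠ 0 := by
        rw [ev_eq_of_polyEq hcf z, ev_smul, ev_pinProductN]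
        exact mul_ne_zero (by exact_mod_cast hκ) (ev_pinProduct_ne_zero z s.pins pe hp)
      have hLz : ev n L z = 0 := ev_lawAt_eq_zero ⟨g, hgn⟩ hzg hh hσ ha k
      have hlin := ev_linear_split z ⟨i, hi⟩ L hdeg
      have hzi : ev n c z * z ⟨i, hi⟩ = ev n num z := by
        rw [hnum, ev_smul]; push_cast
        have : z ⟨i, hi⟩ * ev n c z + ev n (restIn i L) z = 0 := by rw [← hLz, hlin]
        linarith
      refine ih h ⟨z, hh, ?_, ?_, ?_⟩
      · intro t ht
        dsimp only at ht
        rcases mem_logStep ht with ht' | rfl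
        · exact hσ t ht'
        · exact ⟨hi, hzi⟩
      · intro a ha'
        dsimp only at ha'
        obtain ⟨P, hP, rfl⟩ := List.mem_map.1 ha'
        exact ev_substStripI_eq_zero z ⟨g, hgn⟩ ⟨i, hi⟩ num c hzg hzi (ha P hP)
      · intro π' hπ'
        dsimp only at hπ'
        obtain ⟨P, hP, rfl⟩ := List.mem_map.1 hπ'
        exact ev_substLawN_ne_zero z ⟨i, hi⟩ num c hzi hcz (hp P hP)
    | force k j κ pe e =>
      simp only [runL] at h
      split_ifs at h with hc
      simp only [Bool.and_eq_true, decide_eq_true_eq] at hc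
      obtain ⟨⟨⟨⟨⟨hj, hgn⟩, hvp⟩, hκ⟩, he⟩, hform⟩ := hc
      obtain ⟨z, hh, hσ, ha, hp⟩ := hd
      have hzg : z ⟨g, hgn⟩ ≠ 0 := zg_ne_zero_of_hasVarPin (g := ⟨g, hgn⟩) hvp hp
      have hLz : ev n (lawAt n g N hyp s k) z = 0 := ev_lawAt_eq_zero ⟨g, hgn⟩ hzg hh hσ ha k
      rw [ev_eq_of_polyEq hform z, ev_smul, ev_mulN, ev_pinProductN, ev_powQN, ev_var z ⟨j, hj⟩] at hLz
      have hzj : z ⟨j, hj⟩ = 0 := by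
        have h1 : (κ : ℝ) ≠ 0 := by exact_mod_cast hκ
        have h2 := ev_pinProduct_ne_zero z s.pins pe hp
        have h3 : z ⟨j, hj⟩ ^ e = 0 := by
          rcases mul_eq_zero.1 hLz with h | h
          · exact absurd h h1
          · rcases mul_eq_zero.1 h with h' | h'
            · exact absurd h' h2
            · exact h'
        exact pow_eq_zero_iff (by omega) |>.1 h3
      refine ih h ⟨z, hh, hσ, ?_, hp⟩
      intro a ha'
      dsimp only at ha'
      rcases List.mem_append.1 ha' with h' | h'
      · exact ha a h'
      · rw [List.mem_singleton.1 h', ev_var z ⟨j, hj⟩]; exact hzj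

/-! ### Declared states: equality checks and transport -/

/-- Member-by-member `polyEq` equality of substitution logs (same letters). [folklore] -/
def logEq : List LSub → List LSub → Bool
  | [], [] => true
  | a :: as, b :: bs => decide (a.i = b.i) && polyEq a.num b.num && polyEq a.c b.c && logEq as bs
  | _, _ => false

/-- `logEq` logs impose the same relations at every point. [folklore] -/
theorem rel_of_logEq (z : EuclideanSpace ℝ (Fin n)) : ∀ {a b : List LSub}, logEq a b = true →
    (∀ t ∈ a, ∃ hi : t.i < n, ev n t.c z * z ⟨t.i, hi⟩ = ev n t.num z) → ∀ t ∈ b, ∃ hi : t.i < n, ev n t.c z * z ⟨t.i, hi⟩ = ev n t.num z := by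
  intro a
  induction a with
  | nil =>
    intro b h _ t ht
    cases b with
    | nil => simp at ht
    | cons _ _ => simp [logEq] at h
  | cons x xs ih =>
    intro b h hrel t ht
    cases b with
    | nil => simp [logEq] at h
    | cons y ys =>
      obtain ⟨xi, xnum, xc⟩ := x
      obtain ⟨yi, ynum, yc⟩ := y
      simp only [logEq, Bool.and_eq_true, decide_eq_true_eq] at h
      obtain ⟨⟨⟨hi_eq, hnum⟩, hc⟩, hrest⟩ := h
      subst hi_eq
      rcases List.mem_cons.1 ht with rfl | ht'
      · obtain ⟨hi, hx⟩ := hrel ⟨xi, xnum, xc⟩ (List.mem_cons_self ..)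
        refine ⟨hi, ?_⟩
        dsimp only at hx ⊢
        rw [← ev_eq_of_polyEq hnum z, ← ev_eq_of_polyEq hc z]
        exact hx
      · exact ih hrest (fun t' ht'' => hrel t' (List.mem_cons_of_mem _ ht'')) t ht'

/-- A lazy datum of a state is a lazy datum of any declared copy of it (`logEq` / `polyListEq`). [folklore] -/
theorem lazyDatum_of_eq {N : ℕ} {hyp : ℕ → QMvPoly} {s t : LState} (h1 : logEq s.log t.log = true) (h2 : polyListEq s.adj t.adj = true)
    (h3 : polyListEq s.pins t.pins = true) (hd : LazyDatum n N hyp s) : LazyDatum n N hyp t := by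
  obtain ⟨z, hh, hσ, ha, hp⟩ := hd
  refine ⟨z, hh, rel_of_logEq z h1 hσ, ?_, ?_⟩
  · intro a ha'
    obtain ⟨P, hP, hev⟩ := ev_mem_of_polyListEq h2 z a ha'
    rw [← hev]; exact ha P hP
  · intro π hπ'
    obtain ⟨P, hP, hev⟩ := ev_mem_of_polyListEq h3 z π hπ'
    rw [← hev]; exact hp P hP

/-! ### Stages, final slice, assembly -/

/-- **LAZY STAGE CHECK** (Boolean): the steps replay from `s` under `runL` and land on the declared state `s'` (up to `logEq`/`polyEq`). [folklore] -/
def lazyStageCheck (n g N : ℕ) (hyp : ℕ → QMvPoly) (steps : List LStep) (s s' : LState) : Bool :=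
  match runL n g N hyp steps s with
  | none => false
  | some t => logEq t.log s'.log && polyListEq t.adj s'.adj && polyListEq t.pins s'.pins

/-- **SOUNDNESS OF A LAZY STAGE**: a lazy datum of the stage's input state is a lazy datum of its declared output state. [folklore] -/
theorem lazyDatum_of_stageCheck {g N : ℕ} {hyp : ℕ → QMvPoly} {steps : List LStep} {s s' : LState}
    (h : lazyStageCheck n g N hyp steps s s' = true) (hd : LazyDatum n N hyp s) : LazyDatum n N hyp s' := by
  cases hr : runL n g N hyp steps s with
  | none => simp [lazyStageCheck, hr] at h
  | some t =>
    simp only [lazyStageCheck, hr, Bool.and_eq_true] at h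
    exact lazyDatum_of_eq h.1.1 h.1.2 h.2 (lazyDatum_runL g N hyp steps hr hd)

/-- **LAZY FINAL CHECK** (Boolean): the last steps replay from `s` and the point-level Positivstellensatz certificate `c` refutes the resulting
`(adjoined laws, pins)` (for a KILL: the twist pin has become the zero polynomial). [folklore] -/
def lazyFinalCheck (n g N : ℕ) (hyp : ℕ → QMvPoly) (steps : List LStep) (s : LState) (c : PsatzLeaf) : Bool :=
  match runL n g N hyp steps s with
  | none => false
  | some t => pointCheckP n t.adj t.pins [] [] c

/-- **SOUNDNESS OF THE FINAL SLICE**: a checked final slice refutes every lazy datum of its input state. [folklore] -/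
theorem not_lazyDatum_of_finalCheck {g N : ℕ} {hyp : ℕ → QMvPoly} {steps : List LStep} {s : LState} {c : PsatzLeaf}
    (h : lazyFinalCheck n g N hyp steps s c = true) : ¬ LazyDatum n N hyp s := by
  intro hd
  cases hr : runL n g N hyp steps s with
  | none => simp [lazyFinalCheck, hr] at h
  | some t =>
    simp only [lazyFinalCheck, hr] at h
    obtain ⟨z, -, -, ha, hp⟩ := lazyDatum_runL g N hyp steps hr hd
    exact not_pointDatum_of_pointCheckP h ⟨z, ha, hp, by simp, by simp⟩

/-- **ASSEMBLY OF A LAZY STAGED KILL**: if the stages carry every lazy datum of the initial state `([], [], pins ++ [Σ_{j∈J} X_j²])` to a lazy datum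
of a state the final slice refutes, then every real solution of the listed laws `hyp 0, …, hyp (N-1)` with the pins non-zero is untwisted — the
statement of `kills_of_killCheckI` / `kills_of_stagesI` for that law list. [folklore] -/
theorem kills_of_lazyStages {N : ℕ} {hyp : ℕ → QMvPoly} {hyps pins : List QMvPoly} {J : List ℕ} {sK : LState}
    (hhyps : hyps = (List.range N).map hyp)
    (hchain : LazyDatum n N hyp { log := [], adj := [], pins := pins ++ [sumSq n J] } → LazyDatum n N hyp sK)
    (hfin : ¬ LazyDatum n N hyp sK) : Kills n hyps pins [] [] J := by
  intro z hh hp hz hq j hjJ hj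
  by_contra hne
  refine hfin (hchain ⟨z, ?_, by simp, by simp, ?_⟩)
  · intro k hk
    exact hh (hyp k) (by rw [hhyps]; exact List.mem_map.2 ⟨k, List.mem_range.2 hk, rfl⟩)
  · intro π hπ
    rcases List.mem_append.1 hπ with h' | h'
    · exact hp π h'
    · rw [List.mem_singleton.1 h', ev_sumSq]
      have hnn : ∀ x ∈ J.map (fun j => ev n (QMvPoly.var n j) z * ev n (QMvPoly.var n j) z), (0 : ℝ) ≤ x := by
        intro x hx
        obtain ⟨j', -, rfl⟩ := List.mem_map.1 hx
        exact mul_self_nonneg _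
      have hmem : ev n (QMvPoly.var n j) z * ev n (QMvPoly.var n j) z ∈
          J.map (fun j => ev n (QMvPoly.var n j) z * ev n (QMvPoly.var n j) z) := List.mem_map.2 ⟨j, hjJ, rfl⟩
      have hle := List.single_le_sum hnn _ hmem
      have hpos : 0 < ev n (QMvPoly.var n j) z * ev n (QMvPoly.var n j) z := by
        rw [ev_var z ⟨j, hj⟩]; exact mul_self_pos.2 hne
      exact ne_of_gt (lt_of_lt_of_le hpos hle)

/-! ### Self-test (`decide +kernel`): the toy transcript of `…JetCertPsatzElimH`, lazily, in two stages and a final slice -/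

/-- The toy system as an index function: law 0 = `X₀X₁ − 1 − X₀²`, law 1 = `X₁X₂ − X₀X₂`. [folklore] -/
def toyHyp (k : ℕ) : QMvPoly :=
  if k = 0 then [([1, 1, 0], (1 : ℚ)), ([0, 0, 0], (-1 : ℚ)), ([2, 0, 0], (-1 : ℚ))] else [([0, 1, 1], (1 : ℚ)), ([1, 0, 1], (-1 : ℚ))]

/-- State after stage 1 (`elim 0 1 1 [1] keep`): log `X₁ := (1 + X₀²)/X₀`, no adjoined law, pins `[X₀, X₂²]` substituted (unchanged). [folklore] -/
def toyS1 : LState :=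
  { log := [⟨1, [([0, 0, 0], (1 : ℚ)), ([2, 0, 0], (1 : ℚ))], [([1, 0, 0], (1 : ℚ))]⟩], adj := [], pins := [[([1, 0, 0], (1 : ℚ))], [([0, 0, 2], (1 : ℚ))]] }

/-- State after stage 2 (`force 1 2 1 [] 1`: law 1 materialises to `X₂`… times a pin power, so `X₂ = 0` is adjoined). [folklore] -/
def toyS2 : LState :=
  { log := toyS1.log, adj := [[([0, 0, 1], (1 : ℚ))]], pins := toyS1.pins }

/-- Stage 1 of the toy transcript replays lazily onto `toyS1`. [folklore] -/
theorem example_stage1 : lazyStageCheck 3 0 2 toyHyp [.elim 0 1 1 [1] true] { log := [], adj := [], pins := [QMvPoly.var 3 0, sumSq 3 [2]] } toyS1 = true := by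
  decide +kernel

/-- Stage 2 of the toy transcript (the `force` step, with lazy materialisation of law 1 under the log) replays onto `toyS2`. [folklore] -/
theorem example_stage2 : lazyStageCheck 3 0 2 toyHyp [.force 1 2 1 [] 1] toyS1 toyS2 = true := by
  decide +kernel

/-- Final slice: eliminating the adjoined law `X₂` (index `2 = N + 0`) makes the twist pin vanish identically. [folklore] -/
theorem example_final : lazyFinalCheck 3 0 2 toyHyp [.elim 2 2 1 [] false] toyS2 { steps := [], comb := [], e := [0, 1], sos0 := [], sosG := [] } = true := by
  decide +kernel

-- The toy kill, assembled from the two lazy stages and the final slice — the statement `…ElimHStage.example_kills_staged` /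
-- `…ElimI.example_killCheckI` certify eagerly (an `example`, so the landed toy theorem is not restated).
example :
    Kills 3 [[([1, 1, 0], (1 : ℚ)), ([0, 0, 0], (-1 : ℚ)), ([2, 0, 0], (-1 : ℚ))], [([0, 1, 1], (1 : ℚ)), ([1, 0, 1], (-1 : ℚ))]]
      [QMvPoly.var 3 0] [] [] [2] :=
  kills_of_lazyStages (N := 2) (hyp := toyHyp) (by decide)
    (fun hd => lazyDatum_of_stageCheck example_stage2 (lazyDatum_of_stageCheck example_stage1 hd))
    (not_lazyDatum_of_finalCheck example_final)

end Summit.NavierStokesRegularity.NavierStokesRegularity.Theorems.PoloidalWindowDoorLrcModEntireJetCertPsatzElimLazy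

end
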